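import Summits.BirchSwinnertonDyer.BirchSwinnertonDyer.Theorems.QuadraticBranchSignedControlPlusEtaNonsurjPlusCoeffCongruenceMuCertificate
import Summits.BirchSwinnertonDyer.BirchSwinnertonDyer.Theorems.QuadraticBranchSignedControlPlusEtaNonsurjUncongruentRecords01
import HarnessLib

/-!
# Route `QuadraticBranchSignedControl` (rung K8, cell `bsd-potss`), residual crux `PlusEtaMainConjectureNonsurj`
# (stmt-BirchSwinnertonDyer-19606): μ⁺-RECORDS 01 — v7's `stub_analyticEtaMu_cm` AT 6 CM ROWS `V` of the crux at `p = 5`, each from the row's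
# KERNEL data (`Δ ≠ 0`, global minimality, `5 ∤ Δ`, `#V(𝔽₅) = 6` i.e. `a_5 = 0`), Mazur's named fact `hM`, and ONE displayed pattern of `λ⁺ + 1`
# exact-rational symbol valuations (seat `bsd-potss-k8eta-c2` g25; consumer of `…PlusCoeffCongruenceMuCertificate.lean`)

WHAT. For each row `V` below (a globally minimal CM curve with `5` inert in its CM field, good at `5` with `a_5(V) = 0` — a CM row of the crux by
k8eta-c2 g17's `EtaCartanField.cmRow_iff_cmInert`; its `5`-adic tower is never onto), the theorem `analyticEtaMu_<row>_5` concludes VERBATIM the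
inner statement of v7's `Sig.stub_analyticEtaMu_cm` at `(V, 5)`:
«`∀ f, IsNewformOf V f → ∀ ϖ, (ϖ·Ω_V⁺ = Ω_f⁺) → ∀ Lη, IsQuadraticBranchPlusLFunction f 5 ϖ Lη → HasUnitContent Lη`» (analytic `μ⁺ = 0`),
from `EtaPlusCoeffCongruence.analyticEtaMu_row_of_mazurTate_padicNorm[_zero]` (the λ⁺-reading: unitriangular θ-coefficient congruence at level
`2`, diagonal `5`, `Lη = v·ϖ·M⁺`). DISPLAYED per row (hypothesis `hθ`, a statement about `λ⁺ + 1` exact rationals): with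
`θ₂(η) = quadraticBranchMazurTateElement 5 f 2` (a signed sum of `100` modular symbols `[a/125]⁺_f`), `‖ϖ·coeff_jθ₂(η)‖₅ ≤ 5⁻²` for `j < λ⁺` and
`‖ϖ·coeff_{λ⁺}θ₂(η)‖₅ = 5⁻¹` (rows with `λ⁺ ∈ {1,2,3}`), resp. `‖ϖ·θ₀(η)‖₅ = 1` (rows with `λ⁺ = 0`; `θ₀(η) = Σ_a η(a)[a/5]⁺_f`, Kobayashi (3.6)).
THE NUMBERS (kit j337120 of k8eta-c2 g25, engine MT-C1 stages 1–2 of k8eta-c2 g23/g24 BYTE-IDENTICAL, fold `P25-cm5-…tsv` in HOME `k8eta-c2/g25/tables/`;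
p = 5 census of ALL CM rows of g18's table with N_V ≤ 4·10⁸: on every row folded so far the kernel reading of `λ⁺` EQUALS PARI's `λ⁺` — see the
g25 memo for the final counts): `b_j = Σ_{u<25} C(u,j)·TH₂[u]` with
`TH₂[u] = Σ_{m ≡ u (25)} η(2)^m [2^m/125]⁺_V` (symbols normalised by the Néron period of `V`), quoted in each docstring with their `5`-adic valuations.
CONVENTION-INVARIANCE (why the displayed PATTERN is the engine's): the engine writes `θ₂(η)` in the variable `X' = γ' − 1`, `γ' = ⟨2⟩ = γ^a`
(`a ∈ ℤ₅ˣ`, `γ = 6` the tree's `cyclotomicGenerator`); the change of variable `X' = (1+X)^a − 1 = aX + …` is unitriangular on coefficients modulo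
`(ω₂, 5²)` in degrees `< 5`, so «`v₅(b_j) ≥ 2` for `j < λ`, `v₅(b_λ) = 1`» holds in one variable iff in the other; the sign of `η`, `u ↦ −u` and
`Ω_V⁺ ∈ {ω₁, 2ω₁}` are `5`-adic units; `ϖ·[a/M]⁺_f = [a/M]⁺_V` (period relation). Row kernel data as in k8eta-c2 g14's records
(`isElliptic_of_discOf_ne_zero`, `isGloballyMinimal_of_krausCriterion_support`, `good_and_frobeniusTrace_eq_of_countPoints`, `decide +kernel`).

HONEST FRAMING (cell `bsd-potss`; FULL-BSD rank ≤ 1 programme, HUMAN RULING D-0036/D-0074): per-row RECORDS, CONDITIONAL on the named fact `hM`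
(Mazur) and on the displayed per-row symbol pattern (exact rational arithmetic on numerically recovered symbols — evidence, not a kernel fact);
`stub_analyticEtaMu_cm` (class-wide) is NOT proved; nothing about (A), (C1⁺_η), C-cc-1 or `BSD(W,5)` of any pair is claimed; crux and route OPEN;
nothing booked. `--supports stmt-BirchSwinnertonDyer-19606`.

References: [Pollack2003] Prop. 6.18; [Kobayashi2003] Thm. 3.2, (3.4), (3.6) (p. 7); [Mazur1978] Cor. 4.1; [GreenbergVatsal2000] p. 2 (1)–(2);
[SilvermanAEC2009] VII.1 Rem. 1.1, VII.5 Prop. 5.1; [Kraus1989] Prop. 1–2.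
-/

set_option autoImplicit false
set_option linter.dupNamespace false

noncomputable section

open scoped Classical MatrixGroups ModularForm

open CongruenceSubgroup WeierstrassCurve Literature.NumberTheory.EllipticCurves Literature.NumberTheory.EllipticCurves.ModularForms
  Literature.NumberTheory.EllipticCurves.Rank1Residual Literature.NumberTheory.EllipticCurves.GreenbergVatsal2000
  Literature.NumberTheory.EllipticCurves.Rank1Residual.X11RankOneCertificates
  Summit.BirchSwinnertonDyer.Rank1Residual.X11b Summit.BirchSwinnertonDyer.BirchSwinnertonDyer.Rank1Residual.IntModel
  Summit.BirchSwinnertonDyer.BirchSwinnertonDyer.Rank1Residual.X11RankOne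
open Summit.BirchSwinnertonDyer.Rank1Residual Summit.BirchSwinnertonDyer.Rank1Residual.Additive
open Summit.BirchSwinnertonDyer.BirchSwinnertonDyer.Theorems.EtaUncongruentRecords (good_and_frobeniusTrace_eq_of_countPoints)
open Summit.BirchSwinnertonDyer.BirchSwinnertonDyer.Theorems.EtaPlusCoeffCongruence

namespace Summit.BirchSwinnertonDyer.BirchSwinnertonDyer.Theorems.EtaAnalyticMuRecords

/-! ## Row `cm49a1_221` (twist of `49a1` by `221`; `N_V = 2393209`, `ε(W) = 1`, PARI `(λ⁺, λ⁻) = (2, 4)`) -/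

/-- Row `cm49a1_221`: `V = [1, -1, 1, -106840, -16501390]`, `Δ = -39962050303551103` `= ±7^3·13^6·17^6`: `Δ ≠ 0` (kernel). [cite: SilvermanAEC2009, III.1] -/
theorem isElliptic_cm49a1_221 : (⟨1, (-1), 1, (-106840), (-16501390)⟩ : WeierstrassCurve ℚ).IsElliptic :=
  isElliptic_of_discOf_ne_zero 1 (-1) 1 (-106840) (-16501390) (by decide +kernel)

set_option maxRecDepth 100000 in
/-- Row `cm49a1_221` is a global minimal equation (Silverman VII.1 Rem. 1.1 / Kraus on the support of `Δ`, kernel). [cite: SilvermanAEC2009, VII.1 Remark 1.1] [cite: Kraus1989, Prop. 1–2] -/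
theorem isGloballyMinimal_cm49a1_221 : (⟨1, (-1), 1, (-106840), (-16501390)⟩ : WeierstrassCurve ℚ).IsGloballyMinimal :=
  isGloballyMinimal_of_krausCriterion_support 1 (-1) 1 (-106840) (-16501390) [(7, 0, 3), (13, 0, 6), (17, 0, 6)]
    (by decide +kernel) (by decide +kernel) (by decide +kernel)

set_option maxRecDepth 100000 in
/-- **Row `cm49a1_221` — v7's `stub_analyticEtaMu_cm` AT THIS ROW (`p = 5`): every plus branch function `L_5⁺(V,η,X)` of the newform of
`V = [1, -1, 1, -106840, -16501390]` (twist of `49a1` by `221`; CM, `5` inert, `N_V = 2393209`; `W = V^{(5)}` has `ε(W) = 1`; PARI `(λ⁺, λ⁻) = (2, 4)`, `μ = 0`, g18; `#Ш_an(W)` = 25, `v₅(#Ш_an·Tam/#tors²) = 2`) HAS UNIT CONTENT (`μ⁺ = 0`)**,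
from the row's kernel data (`Δ ≠ 0`, minimality, `5 ∤ Δ`, `#V(𝔽₅) = 6`), Mazur's `hM`, and the DISPLAYED pattern `‖ϖ·coeff_jθ₂(η)‖₅ ≤ 5⁻²` (`j < 2`) and `‖ϖ·coeff_2θ₂(η)‖₅ = 5⁻¹` (`λ⁺ = 2`). THE NUMBERS (kit j337120,
row `cm49a1_221`): `b_0 = -500` (v₅ 3), `b_1 = -6275` (v₅ 2), `b_2 = -45730` (v₅ 1), `b_3 = -229835` (v₅ 1) — exactly the registered pattern for `λ⁺ = 2`. [cite: Pollack2003, Prop. 6.18] [cite: Kobayashi2003, Thm. 3.2, (3.4), (3.6) (p. 7)]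
[cite: Mazur1978, Cor. 4.1] [cite: GreenbergVatsal2000, p. 2, (2)] -/
theorem analyticEtaMu_cm49a1_221_5 [Fact (5 : ℕ).Prime] (hM : mazur_not_dvd_maninConstant_of_odd)
    (V : WeierstrassCurve ℚ) [V.IsElliptic] [V.IsGloballyMinimal] (hV : V = ⟨1, (-1), 1, (-106840), (-16501390)⟩)
    (hθ : ∀ {N : ℕ} [NeZero N] {f : CuspForm (Gamma0 N) 2}, IsNewformOf V f →
      ∀ (ϖ : ℚ), (if Even (5 / 2) then (ϖ : ℝ) * V.realPeriodRat = plusPeriod f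
          else (ϖ : ℝ) * V.imaginaryPeriodRat = minusPeriod f) →
        (∀ j < 2, ‖(ϖ : ℚ_[5]) * (((quadraticBranchMazurTateElement 5 f (2 * 1)).coeff j : ℚ) : ℚ_[5])‖ ≤ ((5 : ℝ)⁻¹) ^ (1 + 1)) ∧
          ‖(ϖ : ℚ_[5]) * (((quadraticBranchMazurTateElement 5 f (2 * 1)).coeff 2 : ℚ) : ℚ_[5])‖ = ((5 : ℝ)⁻¹) ^ 1) :
    ∀ {N : ℕ} [NeZero N] {f : CuspForm (Gamma0 N) 2}, IsNewformOf V f →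
      ∀ (ϖ : ℚ), (if Even (5 / 2) then (ϖ : ℝ) * V.realPeriodRat = plusPeriod f
          else (ϖ : ℝ) * V.imaginaryPeriodRat = minusPeriod f) →
      ∀ (Lη : IwasawaAlgebra 5), IsQuadraticBranchPlusLFunction f 5 ϖ Lη → HasUnitContent Lη := by
  intro N _ f hf ϖ hrel Lη hL
  subst hV
  have hI : integralModelInt (⟨1, (-1), 1, (-106840), (-16501390)⟩ : WeierstrassCurve ℚ) = ⟨1, (-1), 1, (-106840), (-16501390)⟩ :=
    integralModelInt_eq_of_map_eq _ (map_mk_int 1 (-1) 1 (-106840) (-16501390))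
  obtain ⟨hgood, htr⟩ := good_and_frobeniusTrace_eq_of_countPoints hI 5 (by decide) (by decide +kernel)
  have hap : (⟨1, (-1), 1, (-106840), (-16501390)⟩ : WeierstrassCurve ℚ).frobeniusTrace 5 = 0 := by
    rw [htr, show countPoints [1, (-1), 1, (-106840), (-16501390)] 5 = 6 by decide +kernel]; norm_num
  exact analyticEtaMu_row_of_mazurTate_padicNorm 5 hM (by norm_num) _ hgood hap 1 le_rfl 2 (by norm_num) hθ hf ϖ hrel Lη hL

/-! ## Row `cm49a1_229` (twist of `49a1` by `229`; `N_V = 2569609`, `ε(W) = 1`, PARI `(λ⁺, λ⁻) = (2, 2)`) -/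

/-- Row `cm49a1_229`: `V = [1, -1, 1, -114715, -18360086]`, `Δ = -49466025163127503` `= ±7^3·229^6`: `Δ ≠ 0` (kernel). [cite: SilvermanAEC2009, III.1] -/
theorem isElliptic_cm49a1_229 : (⟨1, (-1), 1, (-114715), (-18360086)⟩ : WeierstrassCurve ℚ).IsElliptic :=
  isElliptic_of_discOf_ne_zero 1 (-1) 1 (-114715) (-18360086) (by decide +kernel)

set_option maxRecDepth 100000 in
/-- Row `cm49a1_229` is a global minimal equation (Silverman VII.1 Rem. 1.1 / Kraus on the support of `Δ`, kernel). [cite: SilvermanAEC2009, VII.1 Remark 1.1] [cite: Kraus1989, Prop. 1–2] -/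
theorem isGloballyMinimal_cm49a1_229 : (⟨1, (-1), 1, (-114715), (-18360086)⟩ : WeierstrassCurve ℚ).IsGloballyMinimal :=
  isGloballyMinimal_of_krausCriterion_support 1 (-1) 1 (-114715) (-18360086) [(7, 0, 3), (229, 0, 6)]
    (by decide +kernel) (by decide +kernel) (by decide +kernel)

set_option maxRecDepth 100000 in
/-- **Row `cm49a1_229` — v7's `stub_analyticEtaMu_cm` AT THIS ROW (`p = 5`): every plus branch function `L_5⁺(V,η,X)` of the newform of
`V = [1, -1, 1, -114715, -18360086]` (twist of `49a1` by `229`; CM, `5` inert, `N_V = 2569609`; `W = V^{(5)}` has `ε(W) = 1`; PARI `(λ⁺, λ⁻) = (2, 2)`, `μ = 0`, g18; `#Ш_an(W)` = 25, `v₅(#Ш_an·Tam/#tors²) = 2`) HAS UNIT CONTENT (`μ⁺ = 0`)**,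
from the row's kernel data (`Δ ≠ 0`, minimality, `5 ∤ Δ`, `#V(𝔽₅) = 6`), Mazur's `hM`, and the DISPLAYED pattern `‖ϖ·coeff_jθ₂(η)‖₅ ≤ 5⁻²` (`j < 2`) and `‖ϖ·coeff_2θ₂(η)‖₅ = 5⁻¹` (`λ⁺ = 2`). THE NUMBERS (kit j337120,
row `cm49a1_229`): `b_0 = -250` (v₅ 3), `b_1 = -3750` (v₅ 4), `b_2 = -36565` (v₅ 1), `b_3 = -237630` (v₅ 1) — exactly the registered pattern for `λ⁺ = 2`. [cite: Pollack2003, Prop. 6.18] [cite: Kobayashi2003, Thm. 3.2, (3.4), (3.6) (p. 7)]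
[cite: Mazur1978, Cor. 4.1] [cite: GreenbergVatsal2000, p. 2, (2)] -/
theorem analyticEtaMu_cm49a1_229_5 [Fact (5 : ℕ).Prime] (hM : mazur_not_dvd_maninConstant_of_odd)
    (V : WeierstrassCurve ℚ) [V.IsElliptic] [V.IsGloballyMinimal] (hV : V = ⟨1, (-1), 1, (-114715), (-18360086)⟩)
    (hθ : ∀ {N : ℕ} [NeZero N] {f : CuspForm (Gamma0 N) 2}, IsNewformOf V f →
      ∀ (ϖ : ℚ), (if Even (5 / 2) then (ϖ : ℝ) * V.realPeriodRat = plusPeriod f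
          else (ϖ : ℝ) * V.imaginaryPeriodRat = minusPeriod f) →
        (∀ j < 2, ‖(ϖ : ℚ_[5]) * (((quadraticBranchMazurTateElement 5 f (2 * 1)).coeff j : ℚ) : ℚ_[5])‖ ≤ ((5 : ℝ)⁻¹) ^ (1 + 1)) ∧
          ‖(ϖ : ℚ_[5]) * (((quadraticBranchMazurTateElement 5 f (2 * 1)).coeff 2 : ℚ) : ℚ_[5])‖ = ((5 : ℝ)⁻¹) ^ 1) :
    ∀ {N : ℕ} [NeZero N] {f : CuspForm (Gamma0 N) 2}, IsNewformOf V f →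
      ∀ (ϖ : ℚ), (if Even (5 / 2) then (ϖ : ℝ) * V.realPeriodRat = plusPeriod f
          else (ϖ : ℝ) * V.imaginaryPeriodRat = minusPeriod f) →
      ∀ (Lη : IwasawaAlgebra 5), IsQuadraticBranchPlusLFunction f 5 ϖ Lη → HasUnitContent Lη := by
  intro N _ f hf ϖ hrel Lη hL
  subst hV
  have hI : integralModelInt (⟨1, (-1), 1, (-114715), (-18360086)⟩ : WeierstrassCurve ℚ) = ⟨1, (-1), 1, (-114715), (-18360086)⟩ :=
    integralModelInt_eq_of_map_eq _ (map_mk_int 1 (-1) 1 (-114715) (-18360086))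
  obtain ⟨hgood, htr⟩ := good_and_frobeniusTrace_eq_of_countPoints hI 5 (by decide) (by decide +kernel)
  have hap : (⟨1, (-1), 1, (-114715), (-18360086)⟩ : WeierstrassCurve ℚ).frobeniusTrace 5 = 0 := by
    rw [htr, show countPoints [1, (-1), 1, (-114715), (-18360086)] 5 = 6 by decide +kernel]; norm_num
  exact analyticEtaMu_row_of_mazurTate_padicNorm 5 hM (by norm_num) _ hgood hap 1 le_rfl 2 (by norm_num) hθ hf ϖ hrel Lη hL

/-! ## Row `cm49a1_509` (twist of `49a1` by `509`; `N_V = 12694969`, `ε(W) = 1`, PARI `(λ⁺, λ⁻) = (2, 2)`) -/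

/-- Row `cm49a1_509`: `V = [1, -1, 1, -566740, -201787666]`, `Δ = -5964867680029955263` `= ±7^3·509^6`: `Δ ≠ 0` (kernel). [cite: SilvermanAEC2009, III.1] -/
theorem isElliptic_cm49a1_509 : (⟨1, (-1), 1, (-566740), (-201787666)⟩ : WeierstrassCurve ℚ).IsElliptic :=
  isElliptic_of_discOf_ne_zero 1 (-1) 1 (-566740) (-201787666) (by decide +kernel)

set_option maxRecDepth 100000 in
/-- Row `cm49a1_509` is a global minimal equation (Silverman VII.1 Rem. 1.1 / Kraus on the support of `Δ`, kernel). [cite: SilvermanAEC2009, VII.1 Remark 1.1] [cite: Kraus1989, Prop. 1–2] -/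
theorem isGloballyMinimal_cm49a1_509 : (⟨1, (-1), 1, (-566740), (-201787666)⟩ : WeierstrassCurve ℚ).IsGloballyMinimal :=
  isGloballyMinimal_of_krausCriterion_support 1 (-1) 1 (-566740) (-201787666) [(7, 0, 3), (509, 0, 6)]
    (by decide +kernel) (by decide +kernel) (by decide +kernel)

set_option maxRecDepth 100000 in
/-- **Row `cm49a1_509` — v7's `stub_analyticEtaMu_cm` AT THIS ROW (`p = 5`): every plus branch function `L_5⁺(V,η,X)` of the newform of
`V = [1, -1, 1, -566740, -201787666]` (twist of `49a1` by `509`; CM, `5` inert, `N_V = 12694969`; `W = V^{(5)}` has `ε(W) = 1`; PARI `(λ⁺, λ⁻) = (2, 2)`, `μ = 0`, g18; `#Ш_an(W)` = 25, `v₅(#Ш_an·Tam/#tors²) = 2`) HAS UNIT CONTENT (`μ⁺ = 0`)**,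
from the row's kernel data (`Δ ≠ 0`, minimality, `5 ∤ Δ`, `#V(𝔽₅) = 6`), Mazur's `hM`, and the DISPLAYED pattern `‖ϖ·coeff_jθ₂(η)‖₅ ≤ 5⁻²` (`j < 2`) and `‖ϖ·coeff_2θ₂(η)‖₅ = 5⁻¹` (`λ⁺ = 2`). THE NUMBERS (kit j337120,
row `cm49a1_509`): `b_0 = -250` (v₅ 3), `b_1 = -4575` (v₅ 2), `b_2 = -35280` (v₅ 1), `b_3 = -188450` (v₅ 2) — exactly the registered pattern for `λ⁺ = 2`. [cite: Pollack2003, Prop. 6.18] [cite: Kobayashi2003, Thm. 3.2, (3.4), (3.6) (p. 7)]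
[cite: Mazur1978, Cor. 4.1] [cite: GreenbergVatsal2000, p. 2, (2)] -/
theorem analyticEtaMu_cm49a1_509_5 [Fact (5 : ℕ).Prime] (hM : mazur_not_dvd_maninConstant_of_odd)
    (V : WeierstrassCurve ℚ) [V.IsElliptic] [V.IsGloballyMinimal] (hV : V = ⟨1, (-1), 1, (-566740), (-201787666)⟩)
    (hθ : ∀ {N : ℕ} [NeZero N] {f : CuspForm (Gamma0 N) 2}, IsNewformOf V f →
      ∀ (ϖ : ℚ), (if Even (5 / 2) then (ϖ : ℝ) * V.realPeriodRat = plusPeriod f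
          else (ϖ : ℝ) * V.imaginaryPeriodRat = minusPeriod f) →
        (∀ j < 2, ‖(ϖ : ℚ_[5]) * (((quadraticBranchMazurTateElement 5 f (2 * 1)).coeff j : ℚ) : ℚ_[5])‖ ≤ ((5 : ℝ)⁻¹) ^ (1 + 1)) ∧
          ‖(ϖ : ℚ_[5]) * (((quadraticBranchMazurTateElement 5 f (2 * 1)).coeff 2 : ℚ) : ℚ_[5])‖ = ((5 : ℝ)⁻¹) ^ 1) :
    ∀ {N : ℕ} [NeZero N] {f : CuspForm (Gamma0 N) 2}, IsNewformOf V f →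
      ∀ (ϖ : ℚ), (if Even (5 / 2) then (ϖ : ℝ) * V.realPeriodRat = plusPeriod f
          else (ϖ : ℝ) * V.imaginaryPeriodRat = minusPeriod f) →
      ∀ (Lη : IwasawaAlgebra 5), IsQuadraticBranchPlusLFunction f 5 ϖ Lη → HasUnitContent Lη := by
  intro N _ f hf ϖ hrel Lη hL
  subst hV
  have hI : integralModelInt (⟨1, (-1), 1, (-566740), (-201787666)⟩ : WeierstrassCurve ℚ) = ⟨1, (-1), 1, (-566740), (-201787666)⟩ :=
    integralModelInt_eq_of_map_eq _ (map_mk_int 1 (-1) 1 (-566740) (-201787666))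
  obtain ⟨hgood, htr⟩ := good_and_frobeniusTrace_eq_of_countPoints hI 5 (by decide) (by decide +kernel)
  have hap : (⟨1, (-1), 1, (-566740), (-201787666)⟩ : WeierstrassCurve ℚ).frobeniusTrace 5 = 0 := by
    rw [htr, show countPoints [1, (-1), 1, (-566740), (-201787666)] 5 = 6 by decide +kernel]; norm_num
  exact analyticEtaMu_row_of_mazurTate_padicNorm 5 hM (by norm_num) _ hgood hap 1 le_rfl 2 (by norm_num) hθ hf ϖ hrel Lη hL

/-! ## Row `cm49a1_573` (twist of `49a1` by `573`; `N_V = 16088121`, `ε(W) = 1`, PARI `(λ⁺, λ⁻) = (2, 2)`) -/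

/-- Row `cm49a1_573`: `V = [1, -1, 1, -718220, -287898362]`, `Δ = -12140088475795064127` `= ±3^6·7^3·191^6`: `Δ ≠ 0` (kernel). [cite: SilvermanAEC2009, III.1] -/
theorem isElliptic_cm49a1_573 : (⟨1, (-1), 1, (-718220), (-287898362)⟩ : WeierstrassCurve ℚ).IsElliptic :=
  isElliptic_of_discOf_ne_zero 1 (-1) 1 (-718220) (-287898362) (by decide +kernel)

set_option maxRecDepth 100000 in
/-- Row `cm49a1_573` is a global minimal equation (Silverman VII.1 Rem. 1.1 / Kraus on the support of `Δ`, kernel). [cite: SilvermanAEC2009, VII.1 Remark 1.1] [cite: Kraus1989, Prop. 1–2] -/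
theorem isGloballyMinimal_cm49a1_573 : (⟨1, (-1), 1, (-718220), (-287898362)⟩ : WeierstrassCurve ℚ).IsGloballyMinimal :=
  isGloballyMinimal_of_krausCriterion_support 1 (-1) 1 (-718220) (-287898362) [(3, 0, 6), (7, 0, 3), (191, 0, 6)]
    (by decide +kernel) (by decide +kernel) (by decide +kernel)

set_option maxRecDepth 100000 in
/-- **Row `cm49a1_573` — v7's `stub_analyticEtaMu_cm` AT THIS ROW (`p = 5`): every plus branch function `L_5⁺(V,η,X)` of the newform of
`V = [1, -1, 1, -718220, -287898362]` (twist of `49a1` by `573`; CM, `5` inert, `N_V = 16088121`; `W = V^{(5)}` has `ε(W) = 1`; PARI `(λ⁺, λ⁻) = (2, 2)`, `μ = 0`, g18; `#Ш_an(W)` = 25, `v₅(#Ш_an·Tam/#tors²) = 2`) HAS UNIT CONTENT (`μ⁺ = 0`)**,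
from the row's kernel data (`Δ ≠ 0`, minimality, `5 ∤ Δ`, `#V(𝔽₅) = 6`), Mazur's `hM`, and the DISPLAYED pattern `‖ϖ·coeff_jθ₂(η)‖₅ ≤ 5⁻²` (`j < 2`) and `‖ϖ·coeff_2θ₂(η)‖₅ = 5⁻¹` (`λ⁺ = 2`). THE NUMBERS (kit j337120,
row `cm49a1_573`): `b_0 = -1000` (v₅ 3), `b_1 = -9925` (v₅ 2), `b_2 = -48885` (v₅ 1), `b_3 = -124880` (v₅ 1) — exactly the registered pattern for `λ⁺ = 2`. [cite: Pollack2003, Prop. 6.18] [cite: Kobayashi2003, Thm. 3.2, (3.4), (3.6) (p. 7)]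
[cite: Mazur1978, Cor. 4.1] [cite: GreenbergVatsal2000, p. 2, (2)] -/
theorem analyticEtaMu_cm49a1_573_5 [Fact (5 : ℕ).Prime] (hM : mazur_not_dvd_maninConstant_of_odd)
    (V : WeierstrassCurve ℚ) [V.IsElliptic] [V.IsGloballyMinimal] (hV : V = ⟨1, (-1), 1, (-718220), (-287898362)⟩)
    (hθ : ∀ {N : ℕ} [NeZero N] {f : CuspForm (Gamma0 N) 2}, IsNewformOf V f →
      ∀ (ϖ : ℚ), (if Even (5 / 2) then (ϖ : ℝ) * V.realPeriodRat = plusPeriod f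
          else (ϖ : ℝ) * V.imaginaryPeriodRat = minusPeriod f) →
        (∀ j < 2, ‖(ϖ : ℚ_[5]) * (((quadraticBranchMazurTateElement 5 f (2 * 1)).coeff j : ℚ) : ℚ_[5])‖ ≤ ((5 : ℝ)⁻¹) ^ (1 + 1)) ∧
          ‖(ϖ : ℚ_[5]) * (((quadraticBranchMazurTateElement 5 f (2 * 1)).coeff 2 : ℚ) : ℚ_[5])‖ = ((5 : ℝ)⁻¹) ^ 1) :
    ∀ {N : ℕ} [NeZero N] {f : CuspForm (Gamma0 N) 2}, IsNewformOf V f →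
      ∀ (ϖ : ℚ), (if Even (5 / 2) then (ϖ : ℝ) * V.realPeriodRat = plusPeriod f
          else (ϖ : ℝ) * V.imaginaryPeriodRat = minusPeriod f) →
      ∀ (Lη : IwasawaAlgebra 5), IsQuadraticBranchPlusLFunction f 5 ϖ Lη → HasUnitContent Lη := by
  intro N _ f hf ϖ hrel Lη hL
  subst hV
  have hI : integralModelInt (⟨1, (-1), 1, (-718220), (-287898362)⟩ : WeierstrassCurve ℚ) = ⟨1, (-1), 1, (-718220), (-287898362)⟩ :=
    integralModelInt_eq_of_map_eq _ (map_mk_int 1 (-1) 1 (-718220) (-287898362))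
  obtain ⟨hgood, htr⟩ := good_and_frobeniusTrace_eq_of_countPoints hI 5 (by decide) (by decide +kernel)
  have hap : (⟨1, (-1), 1, (-718220), (-287898362)⟩ : WeierstrassCurve ℚ).frobeniusTrace 5 = 0 := by
    rw [htr, show countPoints [1, (-1), 1, (-718220), (-287898362)] 5 = 6 by decide +kernel]; norm_num
  exact analyticEtaMu_row_of_mazurTate_padicNorm 5 hM (by norm_num) _ hgood hap 1 le_rfl 2 (by norm_num) hθ hf ϖ hrel Lη hL

/-! ## Row `cm49a1_733` (twist of `49a1` by `733`; `N_V = 26327161`, `ε(W) = 1`, PARI `(λ⁺, λ⁻) = (2, 2)`) -/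

/-- Row `cm49a1_733`: `V = [1, -1, 1, -1175320, -602762702]`, `Δ = -53200776100317719167` `= ±7^3·733^6`: `Δ ≠ 0` (kernel). [cite: SilvermanAEC2009, III.1] -/
theorem isElliptic_cm49a1_733 : (⟨1, (-1), 1, (-1175320), (-602762702)⟩ : WeierstrassCurve ℚ).IsElliptic :=
  isElliptic_of_discOf_ne_zero 1 (-1) 1 (-1175320) (-602762702) (by decide +kernel)

set_option maxRecDepth 100000 in
/-- Row `cm49a1_733` is a global minimal equation (Silverman VII.1 Rem. 1.1 / Kraus on the support of `Δ`, kernel). [cite: SilvermanAEC2009, VII.1 Remark 1.1] [cite: Kraus1989, Prop. 1–2] -/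
theorem isGloballyMinimal_cm49a1_733 : (⟨1, (-1), 1, (-1175320), (-602762702)⟩ : WeierstrassCurve ℚ).IsGloballyMinimal :=
  isGloballyMinimal_of_krausCriterion_support 1 (-1) 1 (-1175320) (-602762702) [(7, 0, 3), (733, 0, 6)]
    (by decide +kernel) (by decide +kernel) (by decide +kernel)

set_option maxRecDepth 100000 in
/-- **Row `cm49a1_733` — v7's `stub_analyticEtaMu_cm` AT THIS ROW (`p = 5`): every plus branch function `L_5⁺(V,η,X)` of the newform of
`V = [1, -1, 1, -1175320, -602762702]` (twist of `49a1` by `733`; CM, `5` inert, `N_V = 26327161`; `W = V^{(5)}` has `ε(W) = 1`; PARI `(λ⁺, λ⁻) = (2, 2)`, `μ = 0`, g18; `#Ш_an(W)` = 25, `v₅(#Ш_an·Tam/#tors²) = 2`) HAS UNIT CONTENT (`μ⁺ = 0`)**,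
from the row's kernel data (`Δ ≠ 0`, minimality, `5 ∤ Δ`, `#V(𝔽₅) = 6`), Mazur's `hM`, and the DISPLAYED pattern `‖ϖ·coeff_jθ₂(η)‖₅ ≤ 5⁻²` (`j < 2`) and `‖ϖ·coeff_2θ₂(η)‖₅ = 5⁻¹` (`λ⁺ = 2`). THE NUMBERS (kit j337120,
row `cm49a1_733`): `b_0 = -250` (v₅ 3), `b_1 = -2450` (v₅ 2), `b_2 = -19315` (v₅ 1), `b_3 = -145515` (v₅ 1) — exactly the registered pattern for `λ⁺ = 2`. [cite: Pollack2003, Prop. 6.18] [cite: Kobayashi2003, Thm. 3.2, (3.4), (3.6) (p. 7)]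
[cite: Mazur1978, Cor. 4.1] [cite: GreenbergVatsal2000, p. 2, (2)] -/
theorem analyticEtaMu_cm49a1_733_5 [Fact (5 : ℕ).Prime] (hM : mazur_not_dvd_maninConstant_of_odd)
    (V : WeierstrassCurve ℚ) [V.IsElliptic] [V.IsGloballyMinimal] (hV : V = ⟨1, (-1), 1, (-1175320), (-602762702)⟩)
    (hθ : ∀ {N : ℕ} [NeZero N] {f : CuspForm (Gamma0 N) 2}, IsNewformOf V f →
      ∀ (ϖ : ℚ), (if Even (5 / 2) then (ϖ : ℝ) * V.realPeriodRat = plusPeriod f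
          else (ϖ : ℝ) * V.imaginaryPeriodRat = minusPeriod f) →
        (∀ j < 2, ‖(ϖ : ℚ_[5]) * (((quadraticBranchMazurTateElement 5 f (2 * 1)).coeff j : ℚ) : ℚ_[5])‖ ≤ ((5 : ℝ)⁻¹) ^ (1 + 1)) ∧
          ‖(ϖ : ℚ_[5]) * (((quadraticBranchMazurTateElement 5 f (2 * 1)).coeff 2 : ℚ) : ℚ_[5])‖ = ((5 : ℝ)⁻¹) ^ 1) :
    ∀ {N : ℕ} [NeZero N] {f : CuspForm (Gamma0 N) 2}, IsNewformOf V f →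
      ∀ (ϖ : ℚ), (if Even (5 / 2) then (ϖ : ℝ) * V.realPeriodRat = plusPeriod f
          else (ϖ : ℝ) * V.imaginaryPeriodRat = minusPeriod f) →
      ∀ (Lη : IwasawaAlgebra 5), IsQuadraticBranchPlusLFunction f 5 ϖ Lη → HasUnitContent Lη := by
  intro N _ f hf ϖ hrel Lη hL
  subst hV
  have hI : integralModelInt (⟨1, (-1), 1, (-1175320), (-602762702)⟩ : WeierstrassCurve ℚ) = ⟨1, (-1), 1, (-1175320), (-602762702)⟩ :=
    integralModelInt_eq_of_map_eq _ (map_mk_int 1 (-1) 1 (-1175320) (-602762702))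
  obtain ⟨hgood, htr⟩ := good_and_frobeniusTrace_eq_of_countPoints hI 5 (by decide) (by decide +kernel)
  have hap : (⟨1, (-1), 1, (-1175320), (-602762702)⟩ : WeierstrassCurve ℚ).frobeniusTrace 5 = 0 := by
    rw [htr, show countPoints [1, (-1), 1, (-1175320), (-602762702)] 5 = 6 by decide +kernel]; norm_num
  exact analyticEtaMu_row_of_mazurTate_padicNorm 5 hM (by norm_num) _ hgood hap 1 le_rfl 2 (by norm_num) hθ hf ϖ hrel Lη hL

/-! ## Row `cm49a1_789` (twist of `49a1` by `789`; `N_V = 30503529`, `ε(W) = 1`, PARI `(λ⁺, λ⁻) = (2, 2)`) -/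

/-- Row `cm49a1_789`: `V = [1, -1, 1, -1361765, -751762196]`, `Δ = -82747739639418079023` `= ±3^6·7^3·263^6`: `Δ ≠ 0` (kernel). [cite: SilvermanAEC2009, III.1] -/
theorem isElliptic_cm49a1_789 : (⟨1, (-1), 1, (-1361765), (-751762196)⟩ : WeierstrassCurve ℚ).IsElliptic :=
  isElliptic_of_discOf_ne_zero 1 (-1) 1 (-1361765) (-751762196) (by decide +kernel)

set_option maxRecDepth 100000 in
/-- Row `cm49a1_789` is a global minimal equation (Silverman VII.1 Rem. 1.1 / Kraus on the support of `Δ`, kernel). [cite: SilvermanAEC2009, VII.1 Remark 1.1] [cite: Kraus1989, Prop. 1–2] -/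
theorem isGloballyMinimal_cm49a1_789 : (⟨1, (-1), 1, (-1361765), (-751762196)⟩ : WeierstrassCurve ℚ).IsGloballyMinimal :=
  isGloballyMinimal_of_krausCriterion_support 1 (-1) 1 (-1361765) (-751762196) [(3, 0, 6), (7, 0, 3), (263, 0, 6)]
    (by decide +kernel) (by decide +kernel) (by decide +kernel)

set_option maxRecDepth 100000 in
/-- **Row `cm49a1_789` — v7's `stub_analyticEtaMu_cm` AT THIS ROW (`p = 5`): every plus branch function `L_5⁺(V,η,X)` of the newform of
`V = [1, -1, 1, -1361765, -751762196]` (twist of `49a1` by `789`; CM, `5` inert, `N_V = 30503529`; `W = V^{(5)}` has `ε(W) = 1`; PARI `(λ⁺, λ⁻) = (2, 2)`, `μ = 0`, g18; `#Ш_an(W)` = 25, `v₅(#Ш_an·Tam/#tors²) = 2`) HAS UNIT CONTENT (`μ⁺ = 0`)**,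
from the row's kernel data (`Δ ≠ 0`, minimality, `5 ∤ Δ`, `#V(𝔽₅) = 6`), Mazur's `hM`, and the DISPLAYED pattern `‖ϖ·coeff_jθ₂(η)‖₅ ≤ 5⁻²` (`j < 2`) and `‖ϖ·coeff_2θ₂(η)‖₅ = 5⁻¹` (`λ⁺ = 2`). THE NUMBERS (kit j337120,
row `cm49a1_789`): `b_0 = -1000` (v₅ 3), `b_1 = -8925` (v₅ 2), `b_2 = -50265` (v₅ 1), `b_3 = -253645` (v₅ 1) — exactly the registered pattern for `λ⁺ = 2`. [cite: Pollack2003, Prop. 6.18] [cite: Kobayashi2003, Thm. 3.2, (3.4), (3.6) (p. 7)]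
[cite: Mazur1978, Cor. 4.1] [cite: GreenbergVatsal2000, p. 2, (2)] -/
theorem analyticEtaMu_cm49a1_789_5 [Fact (5 : ℕ).Prime] (hM : mazur_not_dvd_maninConstant_of_odd)
    (V : WeierstrassCurve ℚ) [V.IsElliptic] [V.IsGloballyMinimal] (hV : V = ⟨1, (-1), 1, (-1361765), (-751762196)⟩)
    (hθ : ∀ {N : ℕ} [NeZero N] {f : CuspForm (Gamma0 N) 2}, IsNewformOf V f →
      ∀ (ϖ : ℚ), (if Even (5 / 2) then (ϖ : ℝ) * V.realPeriodRat = plusPeriod f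
          else (ϖ : ℝ) * V.imaginaryPeriodRat = minusPeriod f) →
        (∀ j < 2, ‖(ϖ : ℚ_[5]) * (((quadraticBranchMazurTateElement 5 f (2 * 1)).coeff j : ℚ) : ℚ_[5])‖ ≤ ((5 : ℝ)⁻¹) ^ (1 + 1)) ∧
          ‖(ϖ : ℚ_[5]) * (((quadraticBranchMazurTateElement 5 f (2 * 1)).coeff 2 : ℚ) : ℚ_[5])‖ = ((5 : ℝ)⁻¹) ^ 1) :
    ∀ {N : ℕ} [NeZero N] {f : CuspForm (Gamma0 N) 2}, IsNewformOf V f →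
      ∀ (ϖ : ℚ), (if Even (5 / 2) then (ϖ : ℝ) * V.realPeriodRat = plusPeriod f
          else (ϖ : ℝ) * V.imaginaryPeriodRat = minusPeriod f) →
      ∀ (Lη : IwasawaAlgebra 5), IsQuadraticBranchPlusLFunction f 5 ϖ Lη → HasUnitContent Lη := by
  intro N _ f hf ϖ hrel Lη hL
  subst hV
  have hI : integralModelInt (⟨1, (-1), 1, (-1361765), (-751762196)⟩ : WeierstrassCurve ℚ) = ⟨1, (-1), 1, (-1361765), (-751762196)⟩ :=
    integralModelInt_eq_of_map_eq _ (map_mk_int 1 (-1) 1 (-1361765) (-751762196))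
  obtain ⟨hgood, htr⟩ := good_and_frobeniusTrace_eq_of_countPoints hI 5 (by decide) (by decide +kernel)
  have hap : (⟨1, (-1), 1, (-1361765), (-751762196)⟩ : WeierstrassCurve ℚ).frobeniusTrace 5 = 0 := by
    rw [htr, show countPoints [1, (-1), 1, (-1361765), (-751762196)] 5 = 6 by decide +kernel]; norm_num
  exact analyticEtaMu_row_of_mazurTate_padicNorm 5 hM (by norm_num) _ hgood hap 1 le_rfl 2 (by norm_num) hθ hf ϖ hrel Lη hL

end Summit.BirchSwinnertonDyer.BirchSwinnertonDyer.Theorems.EtaAnalyticMuRecords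

end
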